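import Summits.QuantumFields.YangMills.Theorems.BalabanUVNodesN05SubBP2DSlotExistsOfThm33JunctionHGuarded
import Literature.MathematicalPhysics.QuantumFieldTheory.Balaban1983to89.B8Prop6Reg335ZdDomainSeq

/-!
# BalabanUVNodes ∕ N05 ([Balaban1985RegularSpaces] Lemma 1 p. 79 – Thm 8 p. 101): THE «P₂D» ROW WITH THE WITNESS GUARDED — PART 2 of 3: the guarded twins of dag-n05-e's
# `…WithQQPP6` `_P6` (p629759) ∕ `_P6I` (p632654) (Proposition 6's binder discharged): same hypotheses VERBATIM, conclusion
# `∃ lam c₁ ρ₀, 0 < c₁ ∧ 1 ≤ ρ₀ ∧ B8LeafOfRecordSubBP₂D θ (lam.cutSubBP₅ c₁ ρ₀)` behind Proposition 6's thresholds `∃ c35₀ M₆ > 0, ∀ c35 ≥ c35₀, ∀ M₃ ≥ M₆`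

Track A of `YM-PLAN.md` (cell `pub-ymgap`, HUMAN RULING D-0062), node **N05**; seat `pub-ymgap-dag-n05-d` (g14), 2026-08-28; bears on K1⁹ `stmt-QuantumFields-27364`
(`--supports … --as helper`, count-neutral).  The discharge step is dag-n05-e's (p620522 `B8Prop6Reg335ZdDomainSeq.prop6At_binder_domainSeq_holds` at `P := ⊤` +
`IdxB8SubD.domainSeq` + `B8Prop6Reg335ZdAllTorus.prop6At_bgZd_mono`; for `_P6I` the transport along `hmem` through `reg335_bgZd_iff`) — re-run VERBATIM on the guarded
predecessor `…_withQQP_guarded` (part 1), credited; typed here on their word «NOT mine — GO» (cell bus 2026-08-28 13:17Z).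

WHY (director-ym №217 (2)(i); ref-D VERDICT-415): «no N05 discharge is bookable on an unguarded slot; a witness must carry `0 < c₁ ∧ 1 ≤ ρ₀` or the row is guarded first».  The
guard enters at the root (`…SlotExistsGuarded`: Proposition 6's `(ρ₀, c₁⋆)` is print's, `1 ≤ ρ₀`, `0 < c₁⋆`) and is threaded through `…OfThm33JunctionHGuarded` (part 1); here
through the two Proposition-6-discharged editions (NEW module: p629759 ∕ p632654 are not re-landed).

WHAT IS PROVED (two theorems; no estimate; no new definition):
* ★★★ `exists_residB8_b8LeafOfRecordSubBP₂D_cutSubBP₅_of_letters_thm33_junctionH_withQQP_P6_guarded` — p629759's hypotheses VERBATIM (EIGHT binders, `I := MemberZd`) ⊢ the GUARDED row.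
* ★★★ `exists_residB8_b8LeafOfRecordSubBP₂D_cutSubBP₅_of_letters_thm33_junctionH_withQQP_P6I_guarded` — p632654 §2's hypotheses VERBATIM (any `I`, `π : I → MemberZd`, `hmem`) ⊢ the GUARDED row.
HONEST FRAMING: bookkeeping (the guard threaded); 0 estimates; every displayed hypothesis exactly as in p629759 ∕ p632654 (N06 content; `m ≥ 1` OPEN; class-wide satisfiability NOT
claimed — no supplier road on `Ω₀ = ℤᵈ`, JUNCTION ROAD NOTES g13∕g14; (β′-PERIODIC) is the road of record, director-ym №217 (1)); CLASS NOTE (dag-n05-w2) applies verbatim;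
Proposition 7 in the repaired currency (WATCH-P7-CURRENCY-RECORD); count-neutral; **N05 NOT discharged**; K1⁹ NOT claimed; Bałaban AS PRINTED; one finite 𝕋⁴ programme at fixed ε;
nothing continuum ∕ ℝ⁴ ∕ OS ∕ mass-gap ∕ Clay.  No `sorry`, no new definition.  Unit `pub-ymgap-dag-n05-d` (g14).
[cite: Balaban1985RegularSpaces, Lemma 1 – Thm 8 pp.79–101, Prop. 6 (1.134)–(1.138) p.99, (1.33) p.82, (1.3)–(1.5) p.77; Balaban1985BackgroundPropagators, (3.35) p.396, Thm 3.1 p.397, Thm 3.3 p.399]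
-/

noncomputable section

namespace Summit.QuantumFields.YangMills.BalabanUVNodes.N05SubBP2DSlotExistsOfThm33JunctionHWithQQPP6Guarded

open Literature.MathematicalPhysics.QuantumFieldTheory.Balaban1983to89
open Literature.MathematicalPhysics.QuantumFieldTheory.Balaban1983to89.Node00
open Literature.MathematicalPhysics.QuantumFieldTheory.Balaban1983to89.B8IdxB8LawsB (IdxB8LawsB)
open Literature.MathematicalPhysics.QuantumFieldTheory.Balaban1983to89.B8LeafModelZd (ZdIdx)
open Literature.MathematicalPhysics.QuantumFieldTheory.Balaban1983to89.B8TowerBondsPrinted (towerBondsP)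
open Literature.MathematicalPhysics.QuantumFieldTheory.Balaban1983to89.B8SockLettersRD (SockLettersRD)
open Literature.MathematicalPhysics.QuantumFieldTheory.Balaban1983to89.B8Eq138LandauZd (covLap QT)
open B7Prop1Explicit B7Prop2Explicit B7Prop1Local
open B8Ineq132 (InAk covDerivFwd)
open B7Eq78Linearization (zdBlocking QprimeIter)
open B8Eq119TwistedAxial (bgT)
open B8Eq140Level (SideTouches)
open B8Eq1117Concrete (XSpace)
open B8Prop5ContractionKLevel (Bd2)
open B8LambdaSpaceKLevel (wt)
open B9SupplySockB9P3ZdLetters (OpsZd)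
open B9SupplySockB9P3ZdAt (DictAt Prop6At LandauAt SrcAt)
open B9SupplySockB9P3ZdAtLin (LinBddAt)
open B9SupplySockB9P3ZdGammaInAk (CurvAtInAk)
open B9SupplySockB9P3ZdGammaUnivDelta2 (HolderAtδ2)
open B9SupplySockB9P3ZdAtHerm (InvAtH)
open B9SupplySockB9P3ZdGammaUnivDelta2Src (SrcHolderAtδ2)
open B9SupplySockB9P3ZdFrame (MemberZd memZd bgZd ιCfgZd reg335_bgZd_iff)
open B9Eq316AveragingTransposeZdPrinted (withQQP)
open B8Prop6Reg335ZdAllTorus (prop6At_bgZd_mono)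
open B8Prop6Reg335ZdDomainSeq (prop6At_binder_domainSeq_holds)
open Summit.QuantumFields.YangMills.BalabanUVNodes.N05SubBP2DSlotExistsOfThm33JunctionHGuarded
  (exists_residB8_b8LeafOfRecordSubBP₂D_cutSubBP₅_of_letters_thm33_junctionH_withQQP_guarded)
-- `Site` alone could resolve to the torus sites of `Setup.lean`; re-export the `ℤ^d` sites of `B7Prop1Explicit`.

export B7Prop1Explicit (Site)

section WithQQPP6Guarded

/-- ★★★ **GUARDED EDITION** (the witness CARRIES `0 < c₁ ∧ 1 ≤ ρ₀` — director-ym №217 (2)(i), ref-D VERDICT-415) of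
★★★ **THE J-N06→N05 JUNCTION APPLIED ON THE «P₂D» ROAD AT THE `ℤᵈ` FRAME OF RECORD, PROPOSITION 6's BINDER DISCHARGED** — for `θ` with `2 ≤ θ.D`, `5 ≤ θ.L`:
Proposition 6 produces `c35₀, M₆ > 0` such that for every leaf constant `c35 ≥ c35₀` and every junction floor `M₃ ≥ M₆`, [4]'s letters `SLet ∕ SLetUB`, any half-frame
`(geo, Gp, GA, ιLoc, ops)` over `MemberZd θ.D θ.L` with the backgrounds of record `bgZd θ.𝔸 θ.L`, N06's `B9.Thm33Printed c35 geo (bgZd θ.𝔸 θ.L) Gp GA`, the genuine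
averaging letter pin `hops`, and the EIGHT junction binders `DictAt ∕ InvAtH ∕ CurvAtInAk ∕ LandauAt ∕ HolderAtδ2 ∕ LinBddAt ∕ SrcAt ∕ SrcHolderAtδ2` at every
`j : Node00.IdxB8SubD θ` give the N05 row `∃ lam c₁ ρ₀, B8LeafOfRecordSubBP₂D θ (lam.cutSubBP₅ c₁ ρ₀)`.  Proof: the companion theorem with `(I, mem, bg, ιCfg) :=
(MemberZd, memZd, bgZd, ιCfgZd)` and `hP6 := prop6At_binder_domainSeq_holds` (every `IdxB8SubD` member obeys (1.3)–(1.4), `IdxB8SubD.domainSeq`; odd `L` is `θ.hL.1`),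
moved to the leaf's `c35` by `prop6At_bgZd_mono`.  Hypotheses are N06 content; N05 NOT discharged.
[cite: Balaban1985RegularSpaces, Prop. 6 (1.134)–(1.138) p.99, (1.33) p.82, (1.3)–(1.5) p.77, Lemma 1 – Thm 8 pp.79–101; Balaban1985BackgroundPropagators, (3.35) p.396, Thm 3.1 p.397, Thm 3.3 p.399] -/
theorem exists_residB8_b8LeafOfRecordSubBP₂D_cutSubBP₅_of_letters_thm33_junctionH_withQQP_P6_guarded (θ : Stage3Params) (hD : 2 ≤ θ.D) (hL5 : 5 ≤ θ.L)
    [FiniteDimensional ℝ θ.𝔸] :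
    ∃ c35₀ M₆ : ℝ, 0 < c35₀ ∧ 0 < M₆ ∧
      ∀ ⦃c35 : ℝ⦄, c35₀ ≤ c35 → ∀ ⦃M₃ : ℝ⦄, M₆ ≤ M₃ →
      -- [Balaban1985BackgroundPropagators] Thm 3.1's letter bounds and threshold
      ∀ {B₀'H B₂' BG BR cL : ℝ}, 0 < B₀'H → 0 ≤ B₂' → 0 ≤ BG → 0 ≤ BR → 0 < cL →
      -- [4]'s letters AT THE (1.3)–(1.5)-ADMISSIBLE `Ω₀ = ℤᵈ` LAW MEMBERS (p619291's texts verbatim): existence side and uniqueness side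
      (∀ i : ZdIdx θ.D θ.L, i.Ω 0 = Set.univ → IdxB8LawsB θ.L i → B8ConstraintBonds.DomainSeq θ.L i.Ω → (∀ l, l < i.k → ∀ z ∈ i.Λs i.k l, ((θ.L : ℤ) ^ l) • z ∈ B8ConstraintBonds.Lam θ.L i.Ω l) → SockLettersRD (𝔸 := θ.𝔸) θ.L BG BR B₀'H B₂' cL i.η i.k i.Ω i.Λs) →
      (∀ i : ZdIdx θ.D θ.L, i.Ω 0 = Set.univ → IdxB8LawsB θ.L i → B8ConstraintBonds.DomainSeq θ.L i.Ω → (∀ l, l < i.k → ∀ z ∈ i.Λs i.k l, ((θ.L : ℤ) ^ l) • z ∈ B8ConstraintBonds.Lam θ.L i.Ω l) → ∀ α₀ : ℝ, 0 < α₀ → α₀ ≤ cL → ∀ U₀ : Site θ.D → Fin θ.D → θ.𝔸ˣ, (∀ x κ, U₀ x κ ∈ unitaryUnits θ.𝔸) →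
        InAk θ.L i.k i.η α₀ i.Ω U₀ →
        ∃ (g Δ : (Site θ.D → θ.𝔸) →ₗ[ℂ] (Site θ.D → θ.𝔸)) (q : (Site θ.D → θ.𝔸) →ₗ[ℂ] (ℕ → Site θ.D → θ.𝔸))
          (qs : (ℕ → Site θ.D → θ.𝔸) →ₗ[ℂ] (Site θ.D → θ.𝔸)) (Aw c : (ℕ → Site θ.D → θ.𝔸) →ₗ[ℂ] (ℕ → Site θ.D → θ.𝔸))
          (H' : XSpace θ.D i.k θ.𝔸 →ₗ[ℂ] (Site θ.D → θ.𝔸)),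
          (∀ x : Site θ.D → θ.𝔸, (∃ C : ℝ, ∀ y, ‖x y‖ ≤ C) → g (Δ x + qs (Aw (q x))) = x) ∧ (∀ φ, qs (c (q (g (g (qs φ))))) = qs φ) ∧
          (∀ (f : Site θ.D → θ.𝔸), ∀ x ∈ i.Ω 0, Δ f x = covLap i.η U₀ ((i.Ω 0).indicator f) x) ∧
          (∀ (μ : ℕ → Site θ.D → θ.𝔸), ∀ x ∈ i.Ω 0, qs μ x = QT θ.L i.k (i.Λs i.k) U₀ μ x) ∧
          (∀ (f : Site θ.D → θ.𝔸) (n : ℕ), n ≤ i.k → ∀ y ∈ i.Λs i.k n, q f n y = QprimeIter (zdBlocking θ.D θ.L) (bgT θ.L U₀) n f y) ∧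
          (∀ (f : Site θ.D → θ.𝔸) (n : ℕ) (y : Site θ.D), ¬ (n ≤ i.k ∧ y ∈ i.Λs i.k n) → q f n y = 0) ∧
          (∀ (X : XSpace θ.D i.k θ.𝔸) (x : Site θ.D), ‖H' X x‖ ≤ B₀'H * ‖X‖) ∧
          (∀ n, n ≤ i.k → ∀ (X : XSpace θ.D i.k θ.𝔸), ∀ p ∈ {b : Site θ.D × Fin θ.D | SideTouches (i.Ω n) b.1 b.2},
            wt θ.L i.η n * ‖covDerivFwd i.η U₀ p.2 (H' X) p.1‖ ≤ B₀'H * ‖X‖) ∧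
          (∀ X : XSpace θ.D i.k θ.𝔸, Bd2 θ.L i.η i.k i.Ω (covLap i.η U₀ (H' X)) (B₂' * ‖X‖)) ∧
          (∀ (Y : XSpace θ.D i.k θ.𝔸) (n : ℕ) (hn : n ≤ i.k) (y : Site θ.D), y ∈ i.Λs i.k n →
            QprimeIter (zdBlocking θ.D θ.L) (bgT θ.L U₀) n (H' Y) y = Y (⟨n, Nat.lt_succ_of_le hn⟩, y)) ∧
          (∀ (f : Site θ.D → θ.𝔸) (r : ℝ), 0 ≤ r → Bd2 θ.L i.η i.k i.Ω f r →
            (∀ x, ‖g f x‖ ≤ BG * r) ∧ ∀ n, n ≤ i.k → ∀ p ∈ {b : Site θ.D × Fin θ.D | SideTouches (i.Ω n) b.1 b.2},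
              wt θ.L i.η n * ‖covDerivFwd i.η U₀ p.2 (g f) p.1‖ ≤ BG * r) ∧
          (∀ (f : Site θ.D → θ.𝔸) (r : ℝ), 0 ≤ r → Bd2 θ.L i.η i.k i.Ω f r → Bd2 θ.L i.η i.k i.Ω (f - g (qs (c (q (g f))))) (BR * r))) →
      -- N06's HALF-FRAME over the `ℤᵈ` members of record (geometries, the two kernel families of Thms 3.1–3.3 at the backgrounds `bgZd`, the locality map, the letters)
      ∀ (geo : MemberZd θ.D θ.L → B9.Geometry) (Gp GA : ∀ x, B9.KernelFamily (geo x) (bgZd θ.𝔸 θ.L x))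
        (ιLoc : ∀ (M : ℝ) (i : ZdIdx θ.D θ.L) (m : ℕ), (Site θ.D → Fin θ.D → θ.𝔸) → (geo (memZd M i m)).Loc)
        (ops : ℝ → ZdIdx θ.D θ.L → ℕ → OpsZd θ.D θ.𝔸)
      -- THE GENUINE AVERAGING LETTER (as in the companion; `θ.𝔸` finite-dimensional over `ℝ`, a theorem-level instance)
        (τ : θ.𝔸 →ₗ[ℂ] ℂ) {Cτ : ℝ}, (∀ x y : θ.𝔸, |(τ (star x * y)).re| ≤ Cτ * ‖x‖ * ‖y‖) →
      ∀ (ops₀ : ℝ → ZdIdx θ.D θ.L → ℕ → OpsZd θ.D θ.𝔸),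
        (∀ (M : ℝ) (i : ZdIdx θ.D θ.L) (m : ℕ), ops M i m = withQQP τ θ.L (fun m' l => towerBondsP θ.L i.Ω (i.Λs m') l) ops₀ M i m) →
      ∀ {a₃ c69 β cS cSβ : ℝ} {CH : ℝ → ℝ} {len : Site θ.D → ℝ},
      -- N06's THEOREM 3.3 AS PRINTED at the backgrounds of record, by name
        B9.Thm33Printed c35 geo (bgZd θ.𝔸 θ.L) Gp GA →
      -- dag-n06-b's JUNCTION DICTIONARY BINDERS at the (1.3)–(1.5)-admissible members, guarded — EIGHT of them: NO `havg` (companion), NO `hP6` (this file)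
        (∀ (M : ℝ) (j : IdxB8SubD θ) (m : ℕ), 1 ≤ M → M₃ ≤ M → m ≤ j.1.1.1.1.k → DictAt geo (bgZd θ.𝔸 θ.L) GA θ.L memZd (ιCfgZd θ.𝔸 θ.L) ιLoc ops M j.1.1.1.1 m) →
        (∀ (M : ℝ) (j : IdxB8SubD θ) (m : ℕ), 1 ≤ M → M₃ ≤ M → m ≤ j.1.1.1.1.k → InvAtH (bgZd θ.𝔸 θ.L) θ.L memZd (ιCfgZd θ.𝔸 θ.L) ops c35 a₃ M j.1.1.1.1 m) →
        (∀ (M : ℝ) (j : IdxB8SubD θ) (m : ℕ), 1 ≤ M → M₃ ≤ M → m ≤ j.1.1.1.1.k → CurvAtInAk θ.L ops c69 M j.1.1.1.1 m) →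
        (∀ (M : ℝ) (j : IdxB8SubD θ) (m : ℕ), 1 ≤ M → M₃ ≤ M → m ≤ j.1.1.1.1.k → LandauAt (bgZd θ.𝔸 θ.L) θ.L memZd (ιCfgZd θ.𝔸 θ.L) ops c35 a₃ M j.1.1.1.1 m) →
        (∀ (M : ℝ) (j : IdxB8SubD θ) (m : ℕ), 1 ≤ M → M₃ ≤ M → m ≤ j.1.1.1.1.k → HolderAtδ2 geo (bgZd θ.𝔸 θ.L) GA θ.L memZd (ιCfgZd θ.𝔸 θ.L) ops β len CH M j.1.1.1.1 m) →
        (∀ (M : ℝ) (j : IdxB8SubD θ) (m : ℕ), 1 ≤ M → M₃ ≤ M → m ≤ j.1.1.1.1.k → LinBddAt θ.L ops M j.1.1.1.1 m) →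
        (∀ (M : ℝ) (j : IdxB8SubD θ) (m : ℕ), 1 ≤ M → M₃ ≤ M → m ≤ j.1.1.1.1.k → SrcAt (bgZd θ.𝔸 θ.L) θ.L memZd (ιCfgZd θ.𝔸 θ.L) ops c35 a₃ cS M j.1.1.1.1 m) →
        (∀ (M : ℝ) (j : IdxB8SubD θ) (m : ℕ), 1 ≤ M → M₃ ≤ M → m ≤ j.1.1.1.1.k → SrcHolderAtδ2 (bgZd θ.𝔸 θ.L) θ.L memZd (ιCfgZd θ.𝔸 θ.L) ops c35 a₃ β len cSβ M j.1.1.1.1 m) →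
      -- the junction's primitive constants ((3.27) `a₃`, (3.69) `c69`, source `c_S c_Sβ`) and Theorem 8's source size factor `γ₈`
        0 < a₃ → 0 ≤ c69 → 0 ≤ cS → 0 ≤ cSβ → ∀ {γ₈ : ℝ}, 1 ≤ γ₈ →
        ∃ (lam : ResidB8 θ) (c₁ : ℝ) (ρ₀ : ℕ), 0 < c₁ ∧ 1 ≤ ρ₀ ∧ B8LeafOfRecordSubBP₂D θ (lam.cutSubBP₅ c₁ ρ₀) := by
  have hL1 : 1 ≤ θ.L := le_trans (by norm_num) hL5
  -- [B8] PROPOSITION 6 at the `ℤᵈ` frame of record, every (1.3)–(1.4) member (dag-n05-e p620522 §4; odd `L` from the datum)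
  obtain ⟨c35₀, c₆, K₆, M₆, hc35₀, hc₆, hK₆, hM₆, hP6⟩ :=
    prop6At_binder_domainSeq_holds (𝔸 := θ.𝔸) hD hL5 θ.hL.1 (fun _ : ZdIdx θ.D θ.L => True)
  refine ⟨c35₀, M₆, hc35₀, hM₆, ?_⟩
  intro c35 hc35 M₃ hM₃ B₀'H B₂' BG BR cL hB₀'H hB₂' hBG hBR hcL SLet SLetUB geo Gp GA ιLoc ops τ Cτ hCτ ops₀ hops a₃ c69 β cS cSβ CH len
    h33 hdict hinv hcurv hlan hhol hlin hsrc hsrcH ha₃ hc69 hcS hcSβ γ₈ hγ₈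
  refine exists_residB8_b8LeafOfRecordSubBP₂D_cutSubBP₅_of_letters_thm33_junctionH_withQQP_guarded θ hD hL5 hB₀'H hB₂' hBG hBR hcL SLet SLetUB
    geo (bgZd θ.𝔸 θ.L) Gp GA memZd (ιCfgZd θ.𝔸 θ.L) ιLoc ops τ hCτ ops₀ hops h33 hdict ?_ hinv hcurv hlan hhol hlin hsrc hsrcH hc₆ hK₆ ha₃ hc69 hcS hcSβ hγ₈
  -- `hP6` DISCHARGED: the member obeys (1.3)–(1.4) (`IdxB8SubD.domainSeq`), the floor `M₆ ≤ M₃ ≤ M`, and the class constant moved up to the leaf's `c35`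
  intro M j m hM1 hM hm
  exact prop6At_bgZd_mono (𝔸 := θ.𝔸) hL1 hc35 (le_trans zero_le_one hM1) hK₆.le
    (hP6 M j.1.1.1.1 m trivial j.domainSeq (le_trans hM₃ hM))

end WithQQPP6Guarded

section WithQQPP6IGuarded

/-- ★★★ **GUARDED EDITION** (the witness CARRIES `0 < c₁ ∧ 1 ≤ ρ₀` — director-ym №217 (2)(i), ref-D VERDICT-415) of
★★★ **THE INDEX-GENERIC EDITION (v1.1): THE BACKGROUNDS OF RECORD THROUGH A RE-INDEXING MAP `π : I → MemberZd θ.D θ.L`, PROPOSITION 6's BINDER DISCHARGED** —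
for `θ` with `2 ≤ θ.D`, `5 ≤ θ.L`:
Proposition 6 produces `c35₀, M₆ > 0` such that for every leaf constant `c35 ≥ c35₀` and every junction floor `M₃ ≥ M₆`, [4]'s letters `SLet ∕ SLetUB`, any index `I` with a
re-indexing map `π : I → MemberZd θ.D θ.L`, member map `mem` with `π (mem M j m) = memZd M j m` at the admissible members, half-frame `(geo, Gp, GA, ιLoc, ops)` over `I`
with the backgrounds of record `fun i => bgZd θ.𝔸 θ.L (π i)` and `ιCfg := ιCfgZd`, N06's `B9.Thm33Printed c35 geo (fun i => bgZd θ.𝔸 θ.L (π i)) Gp GA` (over `I` —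
sound sub-indices are the consumer's choice), the genuine averaging letter pin `hops`, and the EIGHT junction binders `DictAt ∕ InvAtH ∕ CurvAtInAk ∕ LandauAt ∕ HolderAtδ2 ∕ LinBddAt ∕ SrcAt ∕ SrcHolderAtδ2` at every
`j : Node00.IdxB8SubD θ` give the N05 row `∃ lam c₁ ρ₀, B8LeafOfRecordSubBP₂D θ (lam.cutSubBP₅ c₁ ρ₀)`.  Proof: the companion theorem with `bg := fun i => bgZd θ.𝔸 θ.L (π i)`,
`ιCfg := ιCfgZd` and `hP6 := prop6At_binder_domainSeq_holds` (every `IdxB8SubD` member obeys (1.3)–(1.4), `IdxB8SubD.domainSeq`; odd `L` is `θ.hL.1`), moved to the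
leaf's `c35` by `prop6At_bgZd_mono` and transported along `hmem` through `reg335_bgZd_iff`.  Hypotheses are N06 content; N05 NOT discharged.
[cite: Balaban1985RegularSpaces, Prop. 6 (1.134)–(1.138) p.99, (1.33) p.82, (1.3)–(1.5) p.77, Lemma 1 – Thm 8 pp.79–101; Balaban1985BackgroundPropagators, (3.35) p.396, Thm 3.1 p.397, Thm 3.3 p.399] -/
theorem exists_residB8_b8LeafOfRecordSubBP₂D_cutSubBP₅_of_letters_thm33_junctionH_withQQP_P6I_guarded (θ : Stage3Params) (hD : 2 ≤ θ.D) (hL5 : 5 ≤ θ.L)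
    [FiniteDimensional ℝ θ.𝔸] :
    ∃ c35₀ M₆ : ℝ, 0 < c35₀ ∧ 0 < M₆ ∧
      ∀ ⦃c35 : ℝ⦄, c35₀ ≤ c35 → ∀ ⦃M₃ : ℝ⦄, M₆ ≤ M₃ →
      -- [Balaban1985BackgroundPropagators] Thm 3.1's letter bounds and threshold
      ∀ {B₀'H B₂' BG BR cL : ℝ}, 0 < B₀'H → 0 ≤ B₂' → 0 ≤ BG → 0 ≤ BR → 0 < cL →
      -- [4]'s letters AT THE (1.3)–(1.5)-ADMISSIBLE `Ω₀ = ℤᵈ` LAW MEMBERS (p619291's texts verbatim): existence side and uniqueness side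
      (∀ i : ZdIdx θ.D θ.L, i.Ω 0 = Set.univ → IdxB8LawsB θ.L i → B8ConstraintBonds.DomainSeq θ.L i.Ω → (∀ l, l < i.k → ∀ z ∈ i.Λs i.k l, ((θ.L : ℤ) ^ l) • z ∈ B8ConstraintBonds.Lam θ.L i.Ω l) → SockLettersRD (𝔸 := θ.𝔸) θ.L BG BR B₀'H B₂' cL i.η i.k i.Ω i.Λs) →
      (∀ i : ZdIdx θ.D θ.L, i.Ω 0 = Set.univ → IdxB8LawsB θ.L i → B8ConstraintBonds.DomainSeq θ.L i.Ω → (∀ l, l < i.k → ∀ z ∈ i.Λs i.k l, ((θ.L : ℤ) ^ l) • z ∈ B8ConstraintBonds.Lam θ.L i.Ω l) → ∀ α₀ : ℝ, 0 < α₀ → α₀ ≤ cL → ∀ U₀ : Site θ.D → Fin θ.D → θ.𝔸ˣ, (∀ x κ, U₀ x κ ∈ unitaryUnits θ.𝔸) →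
        InAk θ.L i.k i.η α₀ i.Ω U₀ →
        ∃ (g Δ : (Site θ.D → θ.𝔸) →ₗ[ℂ] (Site θ.D → θ.𝔸)) (q : (Site θ.D → θ.𝔸) →ₗ[ℂ] (ℕ → Site θ.D → θ.𝔸))
          (qs : (ℕ → Site θ.D → θ.𝔸) →ₗ[ℂ] (Site θ.D → θ.𝔸)) (Aw c : (ℕ → Site θ.D → θ.𝔸) →ₗ[ℂ] (ℕ → Site θ.D → θ.𝔸))
          (H' : XSpace θ.D i.k θ.𝔸 →ₗ[ℂ] (Site θ.D → θ.𝔸)),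
          (∀ x : Site θ.D → θ.𝔸, (∃ C : ℝ, ∀ y, ‖x y‖ ≤ C) → g (Δ x + qs (Aw (q x))) = x) ∧ (∀ φ, qs (c (q (g (g (qs φ))))) = qs φ) ∧
          (∀ (f : Site θ.D → θ.𝔸), ∀ x ∈ i.Ω 0, Δ f x = covLap i.η U₀ ((i.Ω 0).indicator f) x) ∧
          (∀ (μ : ℕ → Site θ.D → θ.𝔸), ∀ x ∈ i.Ω 0, qs μ x = QT θ.L i.k (i.Λs i.k) U₀ μ x) ∧
          (∀ (f : Site θ.D → θ.𝔸) (n : ℕ), n ≤ i.k → ∀ y ∈ i.Λs i.k n, q f n y = QprimeIter (zdBlocking θ.D θ.L) (bgT θ.L U₀) n f y) ∧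
          (∀ (f : Site θ.D → θ.𝔸) (n : ℕ) (y : Site θ.D), ¬ (n ≤ i.k ∧ y ∈ i.Λs i.k n) → q f n y = 0) ∧
          (∀ (X : XSpace θ.D i.k θ.𝔸) (x : Site θ.D), ‖H' X x‖ ≤ B₀'H * ‖X‖) ∧
          (∀ n, n ≤ i.k → ∀ (X : XSpace θ.D i.k θ.𝔸), ∀ p ∈ {b : Site θ.D × Fin θ.D | SideTouches (i.Ω n) b.1 b.2},
            wt θ.L i.η n * ‖covDerivFwd i.η U₀ p.2 (H' X) p.1‖ ≤ B₀'H * ‖X‖) ∧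
          (∀ X : XSpace θ.D i.k θ.𝔸, Bd2 θ.L i.η i.k i.Ω (covLap i.η U₀ (H' X)) (B₂' * ‖X‖)) ∧
          (∀ (Y : XSpace θ.D i.k θ.𝔸) (n : ℕ) (hn : n ≤ i.k) (y : Site θ.D), y ∈ i.Λs i.k n →
            QprimeIter (zdBlocking θ.D θ.L) (bgT θ.L U₀) n (H' Y) y = Y (⟨n, Nat.lt_succ_of_le hn⟩, y)) ∧
          (∀ (f : Site θ.D → θ.𝔸) (r : ℝ), 0 ≤ r → Bd2 θ.L i.η i.k i.Ω f r →
            (∀ x, ‖g f x‖ ≤ BG * r) ∧ ∀ n, n ≤ i.k → ∀ p ∈ {b : Site θ.D × Fin θ.D | SideTouches (i.Ω n) b.1 b.2},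
              wt θ.L i.η n * ‖covDerivFwd i.η U₀ p.2 (g f) p.1‖ ≤ BG * r) ∧
          (∀ (f : Site θ.D → θ.𝔸) (r : ℝ), 0 ≤ r → Bd2 θ.L i.η i.k i.Ω f r → Bd2 θ.L i.η i.k i.Ω (f - g (qs (c (q (g f))))) (BR * r))) →
      -- ANY INDEX re-indexed into the `ℤᵈ` members of record by `π`, a member map landing on `memZd` at the admissible members, and N06's HALF-FRAME over it
      -- (geometries, the two kernel families of Thms 3.1–3.3 at the backgrounds `bgZd ∘ π`, the locality map, the letters)
      ∀ {I : Type} (π : I → MemberZd θ.D θ.L) (geo : I → B9.Geometry) (Gp GA : ∀ i, B9.KernelFamily (geo i) (bgZd θ.𝔸 θ.L (π i)))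
        (mem : ℝ → ZdIdx θ.D θ.L → ℕ → I),
        (∀ (M : ℝ) (j : IdxB8SubD θ) (m : ℕ), π (mem M j.1.1.1.1 m) = memZd M j.1.1.1.1 m) →
      ∀ (ιLoc : ∀ (M : ℝ) (i : ZdIdx θ.D θ.L) (m : ℕ), (Site θ.D → Fin θ.D → θ.𝔸) → (geo (mem M i m)).Loc)
        (ops : ℝ → ZdIdx θ.D θ.L → ℕ → OpsZd θ.D θ.𝔸)
      -- THE GENUINE AVERAGING LETTER (as in the companion; `θ.𝔸` finite-dimensional over `ℝ`, a theorem-level instance)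
        (τ : θ.𝔸 →ₗ[ℂ] ℂ) {Cτ : ℝ}, (∀ x y : θ.𝔸, |(τ (star x * y)).re| ≤ Cτ * ‖x‖ * ‖y‖) →
      ∀ (ops₀ : ℝ → ZdIdx θ.D θ.L → ℕ → OpsZd θ.D θ.𝔸),
        (∀ (M : ℝ) (i : ZdIdx θ.D θ.L) (m : ℕ), ops M i m = withQQP τ θ.L (fun m' l => towerBondsP θ.L i.Ω (i.Λs m') l) ops₀ M i m) →
      ∀ {a₃ c69 β cS cSβ : ℝ} {CH : ℝ → ℝ} {len : Site θ.D → ℝ},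
      -- N06's THEOREM 3.3 AS PRINTED at the backgrounds of record, by name
        B9.Thm33Printed c35 geo (fun i => bgZd θ.𝔸 θ.L (π i)) Gp GA →
      -- dag-n06-b's JUNCTION DICTIONARY BINDERS at the (1.3)–(1.5)-admissible members, guarded — EIGHT of them: NO `havg` (companion), NO `hP6` (this file)
        (∀ (M : ℝ) (j : IdxB8SubD θ) (m : ℕ), 1 ≤ M → M₃ ≤ M → m ≤ j.1.1.1.1.k → DictAt geo (fun i => bgZd θ.𝔸 θ.L (π i)) GA θ.L mem (fun M i m U₀ hU₀ => ιCfgZd θ.𝔸 θ.L M i m U₀ hU₀) ιLoc ops M j.1.1.1.1 m) →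
        (∀ (M : ℝ) (j : IdxB8SubD θ) (m : ℕ), 1 ≤ M → M₃ ≤ M → m ≤ j.1.1.1.1.k → InvAtH (fun i => bgZd θ.𝔸 θ.L (π i)) θ.L mem (fun M i m U₀ hU₀ => ιCfgZd θ.𝔸 θ.L M i m U₀ hU₀) ops c35 a₃ M j.1.1.1.1 m) →
        (∀ (M : ℝ) (j : IdxB8SubD θ) (m : ℕ), 1 ≤ M → M₃ ≤ M → m ≤ j.1.1.1.1.k → CurvAtInAk θ.L ops c69 M j.1.1.1.1 m) →
        (∀ (M : ℝ) (j : IdxB8SubD θ) (m : ℕ), 1 ≤ M → M₃ ≤ M → m ≤ j.1.1.1.1.k → LandauAt (fun i => bgZd θ.𝔸 θ.L (π i)) θ.L mem (fun M i m U₀ hU₀ => ιCfgZd θ.𝔸 θ.L M i m U₀ hU₀) ops c35 a₃ M j.1.1.1.1 m) →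
        (∀ (M : ℝ) (j : IdxB8SubD θ) (m : ℕ), 1 ≤ M → M₃ ≤ M → m ≤ j.1.1.1.1.k → HolderAtδ2 geo (fun i => bgZd θ.𝔸 θ.L (π i)) GA θ.L mem (fun M i m U₀ hU₀ => ιCfgZd θ.𝔸 θ.L M i m U₀ hU₀) ops β len CH M j.1.1.1.1 m) →
        (∀ (M : ℝ) (j : IdxB8SubD θ) (m : ℕ), 1 ≤ M → M₃ ≤ M → m ≤ j.1.1.1.1.k → LinBddAt θ.L ops M j.1.1.1.1 m) →
        (∀ (M : ℝ) (j : IdxB8SubD θ) (m : ℕ), 1 ≤ M → M₃ ≤ M → m ≤ j.1.1.1.1.k → SrcAt (fun i => bgZd θ.𝔸 θ.L (π i)) θ.L mem (fun M i m U₀ hU₀ => ιCfgZd θ.𝔸 θ.L M i m U₀ hU₀) ops c35 a₃ cS M j.1.1.1.1 m) →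
        (∀ (M : ℝ) (j : IdxB8SubD θ) (m : ℕ), 1 ≤ M → M₃ ≤ M → m ≤ j.1.1.1.1.k → SrcHolderAtδ2 (fun i => bgZd θ.𝔸 θ.L (π i)) θ.L mem (fun M i m U₀ hU₀ => ιCfgZd θ.𝔸 θ.L M i m U₀ hU₀) ops c35 a₃ β len cSβ M j.1.1.1.1 m) →
      -- the junction's primitive constants ((3.27) `a₃`, (3.69) `c69`, source `c_S c_Sβ`) and Theorem 8's source size factor `γ₈`
        0 < a₃ → 0 ≤ c69 → 0 ≤ cS → 0 ≤ cSβ → ∀ {γ₈ : ℝ}, 1 ≤ γ₈ →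
        ∃ (lam : ResidB8 θ) (c₁ : ℝ) (ρ₀ : ℕ), 0 < c₁ ∧ 1 ≤ ρ₀ ∧ B8LeafOfRecordSubBP₂D θ (lam.cutSubBP₅ c₁ ρ₀) := by
  have hL1 : 1 ≤ θ.L := le_trans (by norm_num) hL5
  -- [B8] PROPOSITION 6 at the `ℤᵈ` frame of record, every (1.3)–(1.4) member (dag-n05-e p620522 §4; odd `L` from the datum)
  obtain ⟨c35₀, c₆, K₆, M₆, hc35₀, hc₆, hK₆, hM₆, hP6⟩ :=
    prop6At_binder_domainSeq_holds (𝔸 := θ.𝔸) hD hL5 θ.hL.1 (fun _ : ZdIdx θ.D θ.L => True)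
  refine ⟨c35₀, M₆, hc35₀, hM₆, ?_⟩
  intro c35 hc35 M₃ hM₃ B₀'H B₂' BG BR cL hB₀'H hB₂' hBG hBR hcL SLet SLetUB I π geo Gp GA mem hmem ιLoc ops τ Cτ hCτ ops₀ hops a₃ c69 β cS cSβ CH len
    h33 hdict hinv hcurv hlan hhol hlin hsrc hsrcH ha₃ hc69 hcS hcSβ γ₈ hγ₈
  refine exists_residB8_b8LeafOfRecordSubBP₂D_cutSubBP₅_of_letters_thm33_junctionH_withQQP_guarded θ hD hL5 hB₀'H hB₂' hBG hBR hcL SLet SLetUB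
    geo (fun i => bgZd θ.𝔸 θ.L (π i)) Gp GA mem (fun M i m U₀ hU₀ => ιCfgZd θ.𝔸 θ.L M i m U₀ hU₀) ιLoc ops τ hCτ ops₀ hops h33 hdict ?_ hinv hcurv hlan hhol hlin hsrc hsrcH hc₆ hK₆ ha₃ hc69 hcS hcSβ hγ₈
  -- `hP6` DISCHARGED: the member obeys (1.3)–(1.4) (`IdxB8SubD.domainSeq`), the floor `M₆ ≤ M₃ ≤ M`, the class constant moved up to the leaf's `c35`,
  -- and the (3.35) field transported from `memZd M j m` to `π (mem M j m)` along `hmem` (the field unfolded by `reg335_bgZd_iff`)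
  intro M j m hM1 hM hm α₀ U₀ hU₀ hα₀ hMα hIn
  have h6 := prop6At_bgZd_mono (𝔸 := θ.𝔸) hL1 hc35 (le_trans zero_le_one hM1) hK₆.le
    (hP6 M j.1.1.1.1 m trivial j.domainSeq (le_trans hM₃ hM)) α₀ U₀ hU₀ hα₀ hMα hIn
  rw [reg335_bgZd_iff] at h6
  show (bgZd θ.𝔸 θ.L (π (mem M j.1.1.1.1 m))).Reg335 c35 (K₆ * α₀) (ιCfgZd θ.𝔸 θ.L M j.1.1.1.1 m U₀ hU₀)
  rw [reg335_bgZd_iff, hmem M j m]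
  exact h6

end WithQQPP6IGuarded

end Summit.QuantumFields.YangMills.BalabanUVNodes.N05SubBP2DSlotExistsOfThm33JunctionHWithQQPP6Guarded

end
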